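import Mathlib
import HarnessLib
import Summits.HubbardSuperconductivity.HubbardSuperconductivity.Theorems.KLProgrammeSalmhoferCutoffSecondDerivBound

/-!
# Route `KLProgramme` — engine-flow child (stmt-HubbardSuperconductivity-20437), stub (C) far part: an EXPLICIT bound on the THIRD derivative of
# Salmhofer's cutoff, `|χ₂‴| ≤ (64/27)·2560·e² (< 44900)` (crude `k!`-style numeral; companion of `…SalmhoferCutoffDerivBound` / `…SecondDerivBound`)

Cell gate-hubbard-kl, seat hubbard-kl-k3c3-p3 (g6).  The cutoff-shell part of the (C1) Jackson-remainder door (k3c3-p1 `jacksonRemainder_curve_jets`,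
my `…KLRegimeFlowShellJets.cutoff_displaced_jets`) multiplies `sup|χ₂^{(l)}|` for `l ≤ k`; orders `≤ 2` are numerals in the tree (`32/3`, `1110`),
orders `3, 4` are not — `klCutoffX4` is a `Classical.choose`.  With the logistic form `σ = smoothTransition = (1+E)⁻¹`, `E = exp(x⁻¹ − (1−x)⁻¹)`,
`σ′ = σ(1−σ)h`, `h = x⁻² + (1−x)⁻²` (k3c2-p2/k3c2-p3), one more differentiation of k3c2-p3's `σ″ = σ(1−σ)[(1−2σ)h² + h′]` gives
  `σ‴ = σ(1−σ)·[(1 − 6σ + 6σ²)h³ + 3(1−2σ)h·h′ + h″]`,   `|1 − 6σ + 6σ²| ≤ 1`,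
so `|σ‴| ≤ σ(1−σ)(h³ + 3h|h′| + h″) ≤ 2560·e²` by the same device (`σ(1−σ) ≤ min(E, E⁻¹)`, `uᵏe^{−u} ≤ k!` on the larger of `x⁻¹, (1−x)⁻¹`).
* §1 derivative bookkeeping on `(0,1)` (`kltd_hasDerivAt_invPow/_oneSubInvPow`, `kltd_hasDerivAt_s/_hh/_hh1`, `kltd_deriv2_eq`, `kltd_hasDerivAt_D2`,
  **`kltd_deriv3_eq`**); §2 `kltd_core3_bound`; §3 **`kltd_abs_deriv3_smoothTransition_le`** (`|σ‴| ≤ 2560e²` on `ℝ`),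
  **`kltd_abs_deriv3_salmhoferCutoff_le`** (`|χ₂‴| ≤ (64/27)·2560·e²`), `…_lt` (`< 44900`).
Everything is proved; no definitions.  Crude by ≈ 10² against the truth (≈ 250); sharp enough where the far mass is `≤ 10⁻³` (n ≥ 3 at `klFlowDeg = 2⁷4ⁿ`).
References: Salmhofer 1999 §4.2.5 (4.70)–(4.71) [cite: BenfattoGiulianiMastropietro2006] §2.2.
-/

noncomputable section

namespace Summit.HubbardSuperconductivity.HubbardSuperconductivity.Theorems.KLRegimeSplit

set_option linter.dupNamespace false -- summit = problem name (single-conjunct summit), D-0017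

open Real Set Filter Literature.MathematicalPhysics.QuantumLattice
open scoped Topology

/-! ## §1 Derivative bookkeeping on `(0,1)` -/

/-- `d/dy (y⁻¹)^(n+1) = −(n+1)·(x⁻¹)^(n+2)` at `x ≠ 0`. -/
theorem kltd_hasDerivAt_invPow (n : ℕ) {x : ℝ} (hx : x ≠ 0) :
    HasDerivAt (fun y : ℝ => (y⁻¹) ^ (n + 1)) (-((n : ℝ) + 1) * (x⁻¹) ^ (n + 2)) x := by
  have h : HasDerivAt (fun y : ℝ => (y⁻¹) ^ (n + 1)) (((n + 1 : ℕ) : ℝ) * (x⁻¹) ^ (n + 1 - 1) * (-(x ^ 2)⁻¹)) x :=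
    (hasDerivAt_inv hx).pow (n + 1)
  refine h.congr_deriv ?_
  simp only [Nat.add_sub_cancel]
  push_cast
  have e : (x ^ 2)⁻¹ = (x⁻¹) ^ 2 := by rw [inv_pow]
  rw [e]
  ring

/-- `d/dy ((1−y)⁻¹)^(n+1) = (n+1)·((1−x)⁻¹)^(n+2)` at `x ≠ 1`. -/
theorem kltd_hasDerivAt_oneSubInvPow (n : ℕ) {x : ℝ} (hx : 1 - x ≠ 0) :
    HasDerivAt (fun y : ℝ => ((1 - y)⁻¹) ^ (n + 1)) (((n : ℝ) + 1) * ((1 - x)⁻¹) ^ (n + 2)) x := by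
  have hl : HasDerivAt (fun y : ℝ => 1 - y) (-1) x := by simpa using (hasDerivAt_id x).const_sub 1
  have hi : HasDerivAt (fun y : ℝ => (1 - y)⁻¹) (-(-1) / (1 - x) ^ 2) x := hl.inv hx
  have h : HasDerivAt (fun y : ℝ => ((1 - y)⁻¹) ^ (n + 1)) (((n + 1 : ℕ) : ℝ) * ((1 - x)⁻¹) ^ (n + 1 - 1) * (-(-1) / (1 - x) ^ 2)) x :=
    hi.pow (n + 1)
  refine h.congr_deriv ?_
  simp only [Nat.add_sub_cancel, neg_neg, one_div]
  push_cast
  have e : ((1 - x) ^ 2)⁻¹ = ((1 - x)⁻¹) ^ 2 := by rw [inv_pow]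
  rw [e]
  ring

/-- `s′ = s(1−s)·h` for the logistic `s = (1+E)⁻¹` on `(0,1)`. -/
theorem kltd_hasDerivAt_s {x : ℝ} (h0 : 0 < x) (h1 : x < 1) :
    HasDerivAt (fun y : ℝ => (1 + Real.exp (y⁻¹ - (1 - y)⁻¹))⁻¹)
      ((1 + Real.exp (x⁻¹ - (1 - x)⁻¹))⁻¹ * (1 - (1 + Real.exp (x⁻¹ - (1 - x)⁻¹))⁻¹) * ((x⁻¹) ^ 2 + ((1 - x)⁻¹) ^ 2)) x := by
  have h := klcd_hasDerivAt_logistic h0 h1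
  refine h.congr_deriv ?_
  rw [mul_div_right_comm, klsd_weight_eq_logistic _ (Real.exp_pos _)]

/-- `h′ = −2x⁻³ + 2(1−x)⁻³`. -/
theorem kltd_hasDerivAt_hh {x : ℝ} (hx0 : x ≠ 0) (hx1 : 1 - x ≠ 0) :
    HasDerivAt (fun y : ℝ => (y⁻¹) ^ 2 + ((1 - y)⁻¹) ^ 2) (-2 * (x⁻¹) ^ 3 + 2 * ((1 - x)⁻¹) ^ 3) x := by
  have h := (kltd_hasDerivAt_invPow 1 hx0).add (kltd_hasDerivAt_oneSubInvPow 1 hx1)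
  refine h.congr_deriv ?_
  push_cast; ring

/-- `h″ = 6x⁻⁴ + 6(1−x)⁻⁴`. -/
theorem kltd_hasDerivAt_hh1 {x : ℝ} (hx0 : x ≠ 0) (hx1 : 1 - x ≠ 0) :
    HasDerivAt (fun y : ℝ => -2 * (y⁻¹) ^ 3 + 2 * ((1 - y)⁻¹) ^ 3) (6 * (x⁻¹) ^ 4 + 6 * ((1 - x)⁻¹) ^ 4) x := by
  have h := ((kltd_hasDerivAt_invPow 2 hx0).const_mul (-2)).add ((kltd_hasDerivAt_oneSubInvPow 2 hx1).const_mul 2)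
  refine h.congr_deriv ?_
  push_cast; ring

/-- **`σ″` on `(0,1)`** in the logistic variables: `σ″ = s(1−s)·[(1−2s)h² + h′]` (k3c2-p3's formula, as an equation). -/
theorem kltd_deriv2_eq {x : ℝ} (h0 : 0 < x) (h1 : x < 1) :
    deriv (deriv Real.smoothTransition) x =
      (1 + Real.exp (x⁻¹ - (1 - x)⁻¹))⁻¹ * (1 - (1 + Real.exp (x⁻¹ - (1 - x)⁻¹))⁻¹) *
        ((1 - 2 * (1 + Real.exp (x⁻¹ - (1 - x)⁻¹))⁻¹) * ((x⁻¹) ^ 2 + ((1 - x)⁻¹) ^ 2) ^ 2 +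
          (-2 * (x⁻¹) ^ 3 + 2 * ((1 - x)⁻¹) ^ 3)) := by
  have hx0 : x ≠ 0 := h0.ne'
  have hx1 : 1 - x ≠ 0 := by linarith
  -- `deriv σ = s(1−s)h` near `x`
  have hev : deriv Real.smoothTransition =ᶠ[𝓝 x] fun y =>
      (1 + Real.exp (y⁻¹ - (1 - y)⁻¹))⁻¹ * (1 - (1 + Real.exp (y⁻¹ - (1 - y)⁻¹))⁻¹) * ((y⁻¹) ^ 2 + ((1 - y)⁻¹) ^ 2) := by
    filter_upwards [Ioo_mem_nhds h0 h1] with y hy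
    rw [klsd_deriv_smoothTransition_eq hy.1 hy.2, mul_div_right_comm, klsd_weight_eq_logistic _ (Real.exp_pos _)]
  rw [hev.deriv_eq]
  have hs := kltd_hasDerivAt_s h0 h1
  have hprod : HasDerivAt (fun y : ℝ =>
      (1 + Real.exp (y⁻¹ - (1 - y)⁻¹))⁻¹ * (1 - (1 + Real.exp (y⁻¹ - (1 - y)⁻¹))⁻¹) * ((y⁻¹) ^ 2 + ((1 - y)⁻¹) ^ 2)) _ x :=
    (hs.mul (hs.const_sub 1)).mul (kltd_hasDerivAt_hh hx0 hx1)
  rw [hprod.deriv]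
  simp only [Pi.mul_apply]
  ring

/-- **`σ‴` on `(0,1)`**: the derivative of `y ↦ s(1−s)[(1−2s)h² + h′]` is `s(1−s)·[(1 − 6s + 6s²)h³ + 3(1−2s)h·h′ + h″]`. -/
theorem kltd_hasDerivAt_D2 {x : ℝ} (h0 : 0 < x) (h1 : x < 1) :
    HasDerivAt (fun y : ℝ =>
      (1 + Real.exp (y⁻¹ - (1 - y)⁻¹))⁻¹ * (1 - (1 + Real.exp (y⁻¹ - (1 - y)⁻¹))⁻¹) *
        ((1 - 2 * (1 + Real.exp (y⁻¹ - (1 - y)⁻¹))⁻¹) * ((y⁻¹) ^ 2 + ((1 - y)⁻¹) ^ 2) ^ 2 +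
          (-2 * (y⁻¹) ^ 3 + 2 * ((1 - y)⁻¹) ^ 3)))
      ((1 + Real.exp (x⁻¹ - (1 - x)⁻¹))⁻¹ * (1 - (1 + Real.exp (x⁻¹ - (1 - x)⁻¹))⁻¹) *
        ((1 - 6 * (1 + Real.exp (x⁻¹ - (1 - x)⁻¹))⁻¹ + 6 * (1 + Real.exp (x⁻¹ - (1 - x)⁻¹))⁻¹ ^ 2) *
            ((x⁻¹) ^ 2 + ((1 - x)⁻¹) ^ 2) ^ 3 +
          3 * (1 - 2 * (1 + Real.exp (x⁻¹ - (1 - x)⁻¹))⁻¹) * ((x⁻¹) ^ 2 + ((1 - x)⁻¹) ^ 2) *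
            (-2 * (x⁻¹) ^ 3 + 2 * ((1 - x)⁻¹) ^ 3) +
          (6 * (x⁻¹) ^ 4 + 6 * ((1 - x)⁻¹) ^ 4))) x := by
  have hx0 : x ≠ 0 := h0.ne'
  have hx1 : 1 - x ≠ 0 := by linarith
  have hs := kltd_hasDerivAt_s h0 h1
  have hh := kltd_hasDerivAt_hh hx0 hx1
  have hh1 := kltd_hasDerivAt_hh1 hx0 hx1
  have hW := hs.mul (hs.const_sub 1)
  have hP := (((hs.const_mul 2).const_sub 1).mul (hh.pow 2)).add hh1
  have h := hW.mul hP
  refine h.congr_deriv ?_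
  simp only [Nat.cast_ofNat, show (2 : ℕ) - 1 = 1 from rfl, pow_one, Pi.pow_apply, Pi.mul_apply, Pi.add_apply]
  ring

/-- **`σ‴` on `(0,1)` as an equation.** -/
theorem kltd_deriv3_eq {x : ℝ} (h0 : 0 < x) (h1 : x < 1) :
    deriv (deriv (deriv Real.smoothTransition)) x =
      (1 + Real.exp (x⁻¹ - (1 - x)⁻¹))⁻¹ * (1 - (1 + Real.exp (x⁻¹ - (1 - x)⁻¹))⁻¹) *
        ((1 - 6 * (1 + Real.exp (x⁻¹ - (1 - x)⁻¹))⁻¹ + 6 * (1 + Real.exp (x⁻¹ - (1 - x)⁻¹))⁻¹ ^ 2) *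
            ((x⁻¹) ^ 2 + ((1 - x)⁻¹) ^ 2) ^ 3 +
          3 * (1 - 2 * (1 + Real.exp (x⁻¹ - (1 - x)⁻¹))⁻¹) * ((x⁻¹) ^ 2 + ((1 - x)⁻¹) ^ 2) *
            (-2 * (x⁻¹) ^ 3 + 2 * ((1 - x)⁻¹) ^ 3) +
          (6 * (x⁻¹) ^ 4 + 6 * ((1 - x)⁻¹) ^ 4)) := by
  have hev : deriv (deriv Real.smoothTransition) =ᶠ[𝓝 x] fun y : ℝ =>
      (1 + Real.exp (y⁻¹ - (1 - y)⁻¹))⁻¹ * (1 - (1 + Real.exp (y⁻¹ - (1 - y)⁻¹))⁻¹) *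
        ((1 - 2 * (1 + Real.exp (y⁻¹ - (1 - y)⁻¹))⁻¹) * ((y⁻¹) ^ 2 + ((1 - y)⁻¹) ^ 2) ^ 2 +
          (-2 * (y⁻¹) ^ 3 + 2 * ((1 - y)⁻¹) ^ 3)) := by
    filter_upwards [Ioo_mem_nhds h0 h1] with y hy using kltd_deriv2_eq hy.1 hy.2
  rw [hev.deriv_eq, (kltd_hasDerivAt_D2 h0 h1).deriv]

/-! ## §2 The numeric core -/

/-- **Core bound**: for `u, w > 0` with `u ≤ 2 ∨ w ≤ 2`, `E = exp(u − w)`, `hh = u² + w²`: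
`E/(1+E)²·(hh³ + 3hh(2u³ + 2w³) + (6u⁴ + 6w⁴)) ≤ 2560·e²`. -/
theorem kltd_core3_bound {u w : ℝ} (hu : 0 < u) (hw : 0 < w) (h : u ≤ 2 ∨ w ≤ 2) :
    Real.exp (u - w) / (1 + Real.exp (u - w)) ^ 2 *
        ((u ^ 2 + w ^ 2) ^ 3 + 3 * (u ^ 2 + w ^ 2) * (2 * u ^ 3 + 2 * w ^ 3) + (6 * u ^ 4 + 6 * w ^ 4)) ≤
      2560 * Real.exp 2 := by
  have hE : 0 < Real.exp (u - w) := Real.exp_pos _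
  have hpoly0 : 0 ≤ (u ^ 2 + w ^ 2) ^ 3 + 3 * (u ^ 2 + w ^ 2) * (2 * u ^ 3 + 2 * w ^ 3) + (6 * u ^ 4 + 6 * w ^ 4) := by positivity
  -- `e^{-t}(t⁶ + 6t⁵ + 18t⁴ + 24t³ + 96t² + 352) ≤ 2560` for `t ≥ 0`
  have hP : ∀ t : ℝ, 0 ≤ t → Real.exp (-t) * (t ^ 6 + 6 * t ^ 5 + 18 * t ^ 4 + 24 * t ^ 3 + 96 * t ^ 2 + 352) ≤ 2560 := by
    intro t ht
    have h6 := klsd_pow_mul_exp_neg_le 6 ht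
    have h5 := klsd_pow_mul_exp_neg_le 5 ht
    have h4 := klsd_pow_mul_exp_neg_le 4 ht
    have h3 := klsd_pow_mul_exp_neg_le 3 ht
    have h2 := klsd_pow_mul_exp_neg_le 2 ht
    have h0 : Real.exp (-t) ≤ 1 := by rw [Real.exp_le_one_iff]; linarith
    simp only [Nat.factorial] at h6 h5 h4 h3 h2
    push_cast at h6 h5 h4 h3 h2
    nlinarith [Real.exp_pos (-t)]
  rcases h with hu2 | hw2
  · have hw' : (u ^ 2 + w ^ 2) ^ 3 + 3 * (u ^ 2 + w ^ 2) * (2 * u ^ 3 + 2 * w ^ 3) + (6 * u ^ 4 + 6 * w ^ 4) ≤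
        w ^ 6 + 6 * w ^ 5 + 18 * w ^ 4 + 24 * w ^ 3 + 96 * w ^ 2 + 352 := by
      have hu4 : u ^ 2 ≤ 4 := by nlinarith
      have hu3 : u ^ 3 ≤ 8 := by nlinarith
      have hu44 : u ^ 4 ≤ 16 := by nlinarith
      have hw0 := hw.le
      nlinarith [sq_nonneg w, pow_nonneg hw0 3, pow_nonneg hw0 4, pow_nonneg hw0 5, mul_nonneg (mul_nonneg hw0 hw0) (sub_nonneg.2 hu4),
        mul_nonneg (pow_nonneg hw0 4) (sub_nonneg.2 hu4), mul_nonneg (pow_nonneg hw0 2) (sub_nonneg.2 hu44),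
        mul_nonneg (pow_nonneg hw0 2) (sub_nonneg.2 hu3), mul_nonneg (pow_nonneg hw0 3) (sub_nonneg.2 hu4)]
    have hwt := (klsd_logistic_weight_le hE).2
    have hE' : Real.exp (u - w) ≤ Real.exp 2 * Real.exp (-w) := by
      rw [← Real.exp_add]; exact Real.exp_le_exp.2 (by linarith)
    calc _ ≤ Real.exp (u - w) * (w ^ 6 + 6 * w ^ 5 + 18 * w ^ 4 + 24 * w ^ 3 + 96 * w ^ 2 + 352) :=
          mul_le_mul hwt hw' hpoly0 hE.le
      _ ≤ (Real.exp 2 * Real.exp (-w)) * (w ^ 6 + 6 * w ^ 5 + 18 * w ^ 4 + 24 * w ^ 3 + 96 * w ^ 2 + 352) :=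
          mul_le_mul_of_nonneg_right hE' (by positivity)
      _ = Real.exp 2 * (Real.exp (-w) * (w ^ 6 + 6 * w ^ 5 + 18 * w ^ 4 + 24 * w ^ 3 + 96 * w ^ 2 + 352)) := by ring
      _ ≤ Real.exp 2 * 2560 := mul_le_mul_of_nonneg_left (hP w hw.le) (Real.exp_pos 2).le
      _ = 2560 * Real.exp 2 := by ring
  · have hu' : (u ^ 2 + w ^ 2) ^ 3 + 3 * (u ^ 2 + w ^ 2) * (2 * u ^ 3 + 2 * w ^ 3) + (6 * u ^ 4 + 6 * w ^ 4) ≤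
        u ^ 6 + 6 * u ^ 5 + 18 * u ^ 4 + 24 * u ^ 3 + 96 * u ^ 2 + 352 := by
      have hw4 : w ^ 2 ≤ 4 := by nlinarith
      have hw3 : w ^ 3 ≤ 8 := by nlinarith
      have hw44 : w ^ 4 ≤ 16 := by nlinarith
      have hu0 := hu.le
      nlinarith [sq_nonneg u, pow_nonneg hu0 3, pow_nonneg hu0 4, pow_nonneg hu0 5, mul_nonneg (mul_nonneg hu0 hu0) (sub_nonneg.2 hw4),
        mul_nonneg (pow_nonneg hu0 4) (sub_nonneg.2 hw4), mul_nonneg (pow_nonneg hu0 2) (sub_nonneg.2 hw44),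
        mul_nonneg (pow_nonneg hu0 2) (sub_nonneg.2 hw3), mul_nonneg (pow_nonneg hu0 3) (sub_nonneg.2 hw4)]
    have hwt := (klsd_logistic_weight_le hE).1
    have hE' : (Real.exp (u - w))⁻¹ ≤ Real.exp 2 * Real.exp (-u) := by
      rw [← Real.exp_neg, ← Real.exp_add]; exact Real.exp_le_exp.2 (by linarith)
    calc _ ≤ (Real.exp (u - w))⁻¹ * (u ^ 6 + 6 * u ^ 5 + 18 * u ^ 4 + 24 * u ^ 3 + 96 * u ^ 2 + 352) :=
          mul_le_mul hwt hu' hpoly0 (by positivity)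
      _ ≤ (Real.exp 2 * Real.exp (-u)) * (u ^ 6 + 6 * u ^ 5 + 18 * u ^ 4 + 24 * u ^ 3 + 96 * u ^ 2 + 352) :=
          mul_le_mul_of_nonneg_right hE' (by positivity)
      _ = Real.exp 2 * (Real.exp (-u) * (u ^ 6 + 6 * u ^ 5 + 18 * u ^ 4 + 24 * u ^ 3 + 96 * u ^ 2 + 352)) := by ring
      _ ≤ Real.exp 2 * 2560 := mul_le_mul_of_nonneg_left (hP u hu.le) (Real.exp_pos 2).le
      _ = 2560 * Real.exp 2 := by ring


/-! ## §3 `|σ‴| ≤ 2560·e²` on `(0,1)`, everywhere, and `χ₂‴` -/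

/-- **`|smoothTransition‴| ≤ 2560e²` on `(0,1)`.** -/
theorem kltd_abs_deriv3_smoothTransition_le_of_mem_Ioo {x : ℝ} (h0 : 0 < x) (h1 : x < 1) :
    |deriv (deriv (deriv Real.smoothTransition)) x| ≤ 2560 * Real.exp 2 := by
  have h1' : 0 < 1 - x := by linarith
  rw [kltd_deriv3_eq h0 h1]
  set u : ℝ := x⁻¹ with hu
  set w : ℝ := (1 - x)⁻¹ with hw
  set sx : ℝ := (1 + Real.exp (u - w))⁻¹ with hsx
  have hupos : 0 < u := inv_pos.2 h0
  have hwpos : 0 < w := inv_pos.2 h1'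
  have hE : 0 < Real.exp (u - w) := Real.exp_pos _
  have hs0 : 0 ≤ sx := by positivity
  have hs1 : sx ≤ 1 := inv_le_one_of_one_le₀ (by linarith)
  have hwt : sx * (1 - sx) = Real.exp (u - w) / (1 + Real.exp (u - w)) ^ 2 := by
    rw [hsx, klsd_weight_eq_logistic _ hE]
  have hwt0 : 0 ≤ sx * (1 - sx) := mul_nonneg hs0 (by linarith)
  rw [abs_mul, abs_of_nonneg hwt0]
  -- the bracket: coefficients `|1 − 6s + 6s²| ≤ 1`, `|1 − 2s| ≤ 1`
  have hc3 : |1 - 6 * sx + 6 * sx ^ 2| ≤ 1 := by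
    rw [abs_le]; constructor <;> nlinarith [sq_nonneg (sx - 1 / 2)]
  have hc2 : |1 - 2 * sx| ≤ 1 := by rw [abs_le]; constructor <;> linarith
  have hh0 : 0 ≤ u ^ 2 + w ^ 2 := by positivity
  have hbr : |(1 - 6 * sx + 6 * sx ^ 2) * (u ^ 2 + w ^ 2) ^ 3 + 3 * (1 - 2 * sx) * (u ^ 2 + w ^ 2) * (-2 * u ^ 3 + 2 * w ^ 3) +
        (6 * u ^ 4 + 6 * w ^ 4)| ≤
      (u ^ 2 + w ^ 2) ^ 3 + 3 * (u ^ 2 + w ^ 2) * (2 * u ^ 3 + 2 * w ^ 3) + (6 * u ^ 4 + 6 * w ^ 4) := by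
    have hA : |(1 - 6 * sx + 6 * sx ^ 2) * (u ^ 2 + w ^ 2) ^ 3| ≤ (u ^ 2 + w ^ 2) ^ 3 := by
      rw [abs_mul, abs_of_nonneg (by positivity : (0:ℝ) ≤ (u ^ 2 + w ^ 2) ^ 3)]
      exact (mul_le_mul_of_nonneg_right hc3 (by positivity)).trans (by rw [one_mul])
    have hB : |3 * (1 - 2 * sx) * (u ^ 2 + w ^ 2) * (-2 * u ^ 3 + 2 * w ^ 3)| ≤
        3 * (u ^ 2 + w ^ 2) * (2 * u ^ 3 + 2 * w ^ 3) := by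
      have hD : |-2 * u ^ 3 + 2 * w ^ 3| ≤ 2 * u ^ 3 + 2 * w ^ 3 := by
        rw [abs_le]; constructor <;> nlinarith [pow_pos hupos 3, pow_pos hwpos 3]
      rw [show 3 * (1 - 2 * sx) * (u ^ 2 + w ^ 2) * (-2 * u ^ 3 + 2 * w ^ 3) =
        (1 - 2 * sx) * ((3 * (u ^ 2 + w ^ 2)) * (-2 * u ^ 3 + 2 * w ^ 3)) by ring, abs_mul, abs_mul,
        abs_of_nonneg (by positivity : (0:ℝ) ≤ 3 * (u ^ 2 + w ^ 2))]
      calc |1 - 2 * sx| * (3 * (u ^ 2 + w ^ 2) * |-2 * u ^ 3 + 2 * w ^ 3|)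
          ≤ 1 * (3 * (u ^ 2 + w ^ 2) * (2 * u ^ 3 + 2 * w ^ 3)) :=
            mul_le_mul hc2 (mul_le_mul_of_nonneg_left hD (by positivity)) (by positivity) zero_le_one
        _ = 3 * (u ^ 2 + w ^ 2) * (2 * u ^ 3 + 2 * w ^ 3) := one_mul _
    have hC : |6 * u ^ 4 + 6 * w ^ 4| ≤ 6 * u ^ 4 + 6 * w ^ 4 := le_of_eq (abs_of_nonneg (by positivity))
    exact (abs_add_le _ _).trans (add_le_add ((abs_add_le _ _).trans (add_le_add hA hB)) hC)
  have hcase : u ≤ 2 ∨ w ≤ 2 := by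
    rcases le_or_gt x (1 / 2) with hx | hx
    · right; rw [hw, inv_le_comm₀ h1' (by norm_num)]; linarith
    · left; rw [hu, inv_le_comm₀ h0 (by norm_num)]; linarith
  calc sx * (1 - sx) * |(1 - 6 * sx + 6 * sx ^ 2) * (u ^ 2 + w ^ 2) ^ 3 +
          3 * (1 - 2 * sx) * (u ^ 2 + w ^ 2) * (-2 * u ^ 3 + 2 * w ^ 3) + (6 * u ^ 4 + 6 * w ^ 4)|
      ≤ sx * (1 - sx) * ((u ^ 2 + w ^ 2) ^ 3 + 3 * (u ^ 2 + w ^ 2) * (2 * u ^ 3 + 2 * w ^ 3) + (6 * u ^ 4 + 6 * w ^ 4)) :=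
        mul_le_mul_of_nonneg_left hbr hwt0
    _ = Real.exp (u - w) / (1 + Real.exp (u - w)) ^ 2 *
          ((u ^ 2 + w ^ 2) ^ 3 + 3 * (u ^ 2 + w ^ 2) * (2 * u ^ 3 + 2 * w ^ 3) + (6 * u ^ 4 + 6 * w ^ 4)) := by rw [hwt]
    _ ≤ 2560 * Real.exp 2 := kltd_core3_bound hupos hwpos hcase

/-- **`|smoothTransition‴| ≤ 2560e²` on all of `ℝ`** (the derivative tower vanishes off `[0,1]`; end points by continuity and density). -/
theorem kltd_abs_deriv3_smoothTransition_le (x : ℝ) : |deriv (deriv (deriv Real.smoothTransition)) x| ≤ 2560 * Real.exp 2 := by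
  have hneg : ∀ y : ℝ, y < 0 → deriv (deriv (deriv Real.smoothTransition)) y = 0 := by
    intro y hy
    have hev : deriv (deriv Real.smoothTransition) =ᶠ[𝓝 y] fun _ => (0 : ℝ) := by
      filter_upwards [Iio_mem_nhds hy] with z hz
      have hev' : deriv Real.smoothTransition =ᶠ[𝓝 z] fun _ => (0 : ℝ) := by
        filter_upwards [Iio_mem_nhds hz] with t ht
        exact klcd_deriv_smoothTransition_eq_zero_of_neg ht
      rw [hev'.deriv_eq]; simp
    rw [hev.deriv_eq]; simp
  have hone : ∀ y : ℝ, 1 < y → deriv (deriv (deriv Real.smoothTransition)) y = 0 := by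
    intro y hy
    have hev : deriv (deriv Real.smoothTransition) =ᶠ[𝓝 y] fun _ => (0 : ℝ) := by
      filter_upwards [Ioi_mem_nhds hy] with z hz
      have hev' : deriv Real.smoothTransition =ᶠ[𝓝 z] fun _ => (0 : ℝ) := by
        filter_upwards [Ioi_mem_nhds hz] with t ht
        have hev'' : Real.smoothTransition =ᶠ[𝓝 t] fun _ => (1 : ℝ) := by
          filter_upwards [Ioi_mem_nhds ht] with r hr
          exact Real.smoothTransition.one_of_one_le hr.le
        rw [hev''.deriv_eq]; simp
      rw [hev'.deriv_eq]; simp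
    rw [hev.deriv_eq]; simp
  have hD : ∀ y ∈ ({0}ᶜ ∩ {1}ᶜ : Set ℝ), |deriv (deriv (deriv Real.smoothTransition)) y| ≤ 2560 * Real.exp 2 := by
    intro y hy
    have hy0 : y ≠ 0 := hy.1
    have hy1 : y ≠ 1 := hy.2
    rcases lt_or_gt_of_ne hy0 with h | h
    · rw [hneg y h, abs_zero]; positivity
    · rcases lt_or_gt_of_ne hy1 with h' | h'
      · exact kltd_abs_deriv3_smoothTransition_le_of_mem_Ioo h h'
      · rw [hone y h', abs_zero]; positivity
  have hdense : Dense ({0}ᶜ ∩ {1}ᶜ : Set ℝ) :=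
    (dense_compl_singleton 0).inter_of_isOpen_left (dense_compl_singleton 1) isOpen_compl_singleton
  have hcont : Continuous fun y => |deriv (deriv (deriv Real.smoothTransition)) y| := by
    have h3 : Continuous (iteratedDeriv 3 Real.smoothTransition) :=
      (Real.smoothTransition.contDiff (n := 3)).continuous_iteratedDeriv 3 le_rfl
    have heq : iteratedDeriv 3 Real.smoothTransition = deriv (deriv (deriv Real.smoothTransition)) := by
      rw [iteratedDeriv_succ, iteratedDeriv_succ, iteratedDeriv_one]
    rw [heq] at h3
    exact h3.abs
  have hclosed : IsClosed {y : ℝ | |deriv (deriv (deriv Real.smoothTransition)) y| ≤ 2560 * Real.exp 2} :=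
    isClosed_le hcont continuous_const
  have hsub : closure ({0}ᶜ ∩ {1}ᶜ : Set ℝ) ⊆ {y : ℝ | |deriv (deriv (deriv Real.smoothTransition)) y| ≤ 2560 * Real.exp 2} :=
    hclosed.closure_subset_iff.mpr hD
  rw [hdense.closure_eq] at hsub
  exact hsub (mem_univ x)

/-- The second derivative of `χ₂` as a function: `χ₂″(x) = (4/3)²·σ″((4x−1)/3)`. -/
theorem kltd_deriv2_salmhoferCutoff_eq :
    deriv (deriv salmhoferCutoff) = fun x => deriv (deriv Real.smoothTransition) ((4 * x - 1) / 3) * (4 / 3) * (4 / 3) := by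
  funext x
  rw [klsd_deriv_salmhoferCutoff_eq]
  have hℓ : HasDerivAt (fun y : ℝ => (4 * y - 1) / 3) (4 / 3) x := by
    have := ((hasDerivAt_id x).const_mul 4).sub_const 1
    have := this.div_const 3
    simpa using this
  have hdiff : Differentiable ℝ (deriv Real.smoothTransition) := by
    have h := (Real.smoothTransition.contDiff (n := 2)).differentiable_iteratedDeriv 1 (by norm_num)
    rwa [iteratedDeriv_one] at h
  have hs : HasDerivAt (deriv Real.smoothTransition) (deriv (deriv Real.smoothTransition) ((4 * x - 1) / 3)) ((4 * x - 1) / 3) :=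
    (hdiff _).hasDerivAt
  have hcomp : HasDerivAt (fun y => deriv Real.smoothTransition ((4 * y - 1) / 3) * (4 / 3))
      (deriv (deriv Real.smoothTransition) ((4 * x - 1) / 3) * (4 / 3) * (4 / 3)) x :=
    ((hs.comp x hℓ).congr_of_eventuallyEq (Eventually.of_forall fun y => rfl)).mul_const _
  exact hcomp.deriv

/-- **`|χ₂‴ x| ≤ (64/27)·2560·e²`** for Salmhofer's cutoff `χ₂(x) = smoothTransition((4x−1)/3)`. -/
theorem kltd_abs_deriv3_salmhoferCutoff_le (x : ℝ) : |deriv (deriv (deriv salmhoferCutoff)) x| ≤ 64 / 27 * (2560 * Real.exp 2) := by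
  rw [kltd_deriv2_salmhoferCutoff_eq]
  have hℓ : HasDerivAt (fun y : ℝ => (4 * y - 1) / 3) (4 / 3) x := by
    have := ((hasDerivAt_id x).const_mul 4).sub_const 1
    have := this.div_const 3
    simpa using this
  have hdiff : Differentiable ℝ (deriv (deriv Real.smoothTransition)) := by
    have h := (Real.smoothTransition.contDiff (n := 3)).differentiable_iteratedDeriv 2 (by norm_num)
    rwa [iteratedDeriv_succ, iteratedDeriv_one] at h
  have hs : HasDerivAt (deriv (deriv Real.smoothTransition)) (deriv (deriv (deriv Real.smoothTransition)) ((4 * x - 1) / 3))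
      ((4 * x - 1) / 3) := (hdiff _).hasDerivAt
  have hcomp : HasDerivAt (fun y => deriv (deriv Real.smoothTransition) ((4 * y - 1) / 3) * (4 / 3) * (4 / 3))
      (deriv (deriv (deriv Real.smoothTransition)) ((4 * x - 1) / 3) * (4 / 3) * (4 / 3) * (4 / 3)) x :=
    (((hs.comp x hℓ).congr_of_eventuallyEq (Eventually.of_forall fun y => rfl)).mul_const _).mul_const _
  rw [hcomp.deriv, abs_mul, abs_mul, abs_mul, abs_of_pos (by norm_num : (0:ℝ) < 4 / 3)]
  have := kltd_abs_deriv3_smoothTransition_le ((4 * x - 1) / 3)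
  nlinarith [Real.exp_pos 2, abs_nonneg (deriv (deriv (deriv Real.smoothTransition)) ((4 * x - 1) / 3))]

/-- Numeric form: `|χ₂‴ x| < 44900` (`e² < 7.39`). -/
theorem kltd_abs_deriv3_salmhoferCutoff_lt (x : ℝ) : |deriv (deriv (deriv salmhoferCutoff)) x| < 44900 := by
  have h := kltd_abs_deriv3_salmhoferCutoff_le x
  have he : Real.exp 1 < 2.7182818286 := Real.exp_one_lt_d9
  have he0 : 0 < Real.exp 1 := Real.exp_pos 1
  have h2 : Real.exp 2 = Real.exp 1 * Real.exp 1 := by rw [← Real.exp_add]; norm_num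
  nlinarith

/-- **The tier-2 cutoff numeral at order 3 in `iteratedFDeriv` form**: `‖D³χ₂(x)‖ ≤ 44900`. -/
theorem norm_iteratedFDeriv_three_salmhoferCutoff_le (x : ℝ) : ‖iteratedFDeriv ℝ 3 salmhoferCutoff x‖ ≤ 44900 := by
  rw [norm_iteratedFDeriv_eq_norm_iteratedDeriv, Real.norm_eq_abs, iteratedDeriv_succ, iteratedDeriv_succ, iteratedDeriv_one]
  exact (kltd_abs_deriv3_salmhoferCutoff_lt x).le

end Summit.HubbardSuperconductivity.HubbardSuperconductivity.Theorems.KLRegimeSplit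

end
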